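import Mathlib
import Literature.Analysis.FluidPDE.TrajectoryJacobianLiouville
import Literature.Analysis.FluidPDE.ParticleTrajectoryFlow
import Literature.Analysis.FluidPDE.TaoEnstrophyLocalisation
import Literature.Analysis.FluidPDE.ClassicalSolution
import Literature.Analysis.FluidPDE.AxisymmetricEuler
import HarnessLib

/-!
# Crux `EulerZoomLiouville.PowerGaugeEulerLiouville` (stmt-NavierStokesRegularity-19832), line `swirlfree-ledger`, stub S2 — part 1:
# THE LOCALISED PARTICLE FLOW of a classical velocity field (cut-off field, confinement, axis invariance, incompressible Jacobian)

Route №10 `EulerZoomLiouville` (NavierStokesRegularity), crux E.  Line `swirlfree-ledger` (ideator ns-idea-11), registered stub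
`stub_materialConfinement` (S2, the hardest provable stub): *on the classical axisymmetric swirl-free stratum with sub-parabolic drift the
axis ledger `∫_{B} (|curl u|/r)^q` is monotone along the flow*.  Its proof is Lagrangian (material conservation of `ω_θ/r`, volume
preservation, confinement of parcels), and the tree's particle-trajectory calculus (`Literature/Analysis/ODE/EvolutionMap*`,
`…/FluidPDE/ParticleTrajectoryFlow`, `…/TrajectoryJacobianLiouville`) is keyed to the Cauchy–Lipschitz hypothesis
`ODE.IsUniformlyLipschitzOn u S` — ONE spatial Lipschitz constant on each compact set of times — which a member of the stratum
(smooth, with a sup bound `‖u(τ)‖_∞ ≤ M(−τ)^{−κ}` but NO gradient bound) need not satisfy.  This file supplies the LOCALISATION that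
makes the tree's calculus applicable:

* `isUniformlyLipschitzOn_bump_smul` — the cut-off field `w(t,x) = χ(x) u(t,x)` (`χ` a `ContDiffBump` about the origin) of a field
  jointly smooth on an open time set has a bounded gradient on every compact set of times (compactness of `C × supp χ`; outside the
  support the gradient vanishes), hence satisfies `ODE.IsUniformlyLipschitzOn w S`; it coincides with `u` (values and gradients) on
  the ball where `χ = 1` (`bump_smul_eventuallyEq`);
* `norm_evolutionMap_sub_le` — CONFINEMENT: if `‖w(s,·)‖_∞ ≤ M₀(−s)^{−κ₀}` on `[t₁,t₀]` (`t₀ < 0`, `κ₀ < 1`), the trajectory through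
  `x` at time `t₀` has `‖φ(s,t₀,x) − x‖ ≤ M₀((−s)^{1−κ₀} − (−t₀)^{1−κ₀})/(1−κ₀)` for `s ∈ [t₁,t₀]` (the mean-value inequality with a
  moving bound, Mathlib `image_norm_le_of_norm_deriv_right_le_deriv_boundary'`);
* `evolutionMap_mem_axis` / `cylRadius_evolutionMap_ne_zero` — if the horizontal components of `w` vanish on the symmetry axis (true for
  every axisymmetric field, the tree's `Wei2016.apply_zero_one_eq_zero_of_axis`), the flow preserves the axis (the reduced ODE on the axis + uniqueness), hence maps
  off-axis points to off-axis points;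
* `det_fderiv_evolutionMap_eq_one_of_divergence`, `lintegral_comp_evolutionMap_le` — Liouville's formula along a trajectory meeting only
  points of vanishing divergence gives `det Dφ = 1`, and then `∫_A G ∘ φ = ∫_{φ(A)} G ≤ ∫_B G` whenever `φ(A) ⊆ B`
  (Mathlib `lintegral_image_eq_lintegral_abs_det_fderiv_mul`).

Everything is stated for an ARBITRARY field `w` with the Cauchy–Lipschitz hypotheses (no `def` is introduced; the cut-off field is
written `fun t x => χ x • u t x`).  Part 2 (`…SwirlfreeLedgerConfinement`) adds the material conservation of `ω_θ/r` and assembles S2.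

WHAT THIS IS NOT: not NS, not the crux — helper calculus `--supports` stmt-19832 on the line `swirlfree-ledger`; no summit statement is
proved here.  [cite: MajdaBertozziCUP2002, §1.3 Prop. 1.4, §2.3.3 (2.58)–(2.59), §4.2 (trajectory control); Teschl2012, Thm. 2.2, Cor. 2.6]
-/

noncomputable section

-- flat `Theorems/<Route><Decl>…` files of one crux share the namespace of the crux (tree convention)
set_option linter.dupNamespace false

open MeasureTheory Set Filter Topology Metric Function
open scoped NNReal ENNReal ContDiff

namespace Summit.NavierStokesRegularity.NavierStokesRegularity.Theorems.PowerGaugeEulerLiouville.SwirlfreeLedger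

open Literature.Analysis Literature.Analysis.FluidPDE

variable {u w : ℝ → EuclideanSpace ℝ (Fin 3) → EuclideanSpace ℝ (Fin 3)} {S : Set ℝ}

/-! ### The cut-off field `χ u` -/

/-- The cut-off `χ u` of a jointly smooth field is jointly smooth. [folklore] -/
theorem isSmoothSpaceTimeOn_bump_smul (χ : ContDiffBump (0 : EuclideanSpace ℝ (Fin 3))) (hu : IsSmoothSpaceTimeOn S u) :
    IsSmoothSpaceTimeOn S (fun t x => χ x • u t x) := by
  have h1 : ContDiffOn ℝ ∞ (fun p : ℝ × EuclideanSpace ℝ (Fin 3) => χ p.2) (S ×ˢ univ) :=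
    (χ.contDiff.comp contDiff_snd).contDiffOn
  exact h1.smul hu

/-- Outside the support of the bump the cut-off field is locally zero, so its gradient vanishes. [folklore] -/
theorem fderiv_bump_smul_eq_zero (χ : ContDiffBump (0 : EuclideanSpace ℝ (Fin 3)))
    (v : EuclideanSpace ℝ (Fin 3) → EuclideanSpace ℝ (Fin 3)) {y : EuclideanSpace ℝ (Fin 3)} (hy : χ.rOut < ‖y‖) :
    fderiv ℝ (fun x => χ x • v x) y = 0 := by
  have h : (fun x => χ x • v x) =ᶠ[𝓝 y] fun _ => (0 : EuclideanSpace ℝ (Fin 3)) := by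
    have hopen : IsOpen {x : EuclideanSpace ℝ (Fin 3) | χ.rOut < ‖x‖} := isOpen_lt continuous_const continuous_norm
    filter_upwards [hopen.mem_nhds hy] with x hx
    have hx' : χ.rOut ≤ dist x 0 := by rw [dist_zero_right]; exact le_of_lt hx
    rw [χ.zero_of_le_dist hx', zero_smul]
  rw [h.fderiv_eq]
  exact fderiv_const_apply _

/-- On the ball where `χ = 1` the cut-off field is locally the field itself. [folklore] -/
theorem bump_smul_eventuallyEq (χ : ContDiffBump (0 : EuclideanSpace ℝ (Fin 3)))
    (v : EuclideanSpace ℝ (Fin 3) → EuclideanSpace ℝ (Fin 3)) {y : EuclideanSpace ℝ (Fin 3)} (hy : y ∈ ball (0 : EuclideanSpace ℝ (Fin 3)) χ.rIn) :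
    (fun x => χ x • v x) =ᶠ[𝓝 y] v := by
  filter_upwards [χ.eventuallyEq_one_of_mem_ball hy] with x hx
  rw [hx, Pi.one_apply, one_smul]

/-- In particular the two fields have the same value and the same gradient there. [folklore] -/
theorem fderiv_bump_smul_eq (χ : ContDiffBump (0 : EuclideanSpace ℝ (Fin 3)))
    (v : EuclideanSpace ℝ (Fin 3) → EuclideanSpace ℝ (Fin 3)) {y : EuclideanSpace ℝ (Fin 3)} (hy : y ∈ ball (0 : EuclideanSpace ℝ (Fin 3)) χ.rIn) :
    fderiv ℝ (fun x => χ x • v x) y = fderiv ℝ v y :=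
  (bump_smul_eventuallyEq χ v hy).fderiv_eq

/-- The speed of the cut-off field is at most the speed of the field (`0 ≤ χ ≤ 1`). [folklore] -/
theorem norm_bump_smul_le (χ : ContDiffBump (0 : EuclideanSpace ℝ (Fin 3)))
    (v : EuclideanSpace ℝ (Fin 3) → EuclideanSpace ℝ (Fin 3)) (y : EuclideanSpace ℝ (Fin 3)) : ‖χ y • v y‖ ≤ ‖v y‖ := by
  rw [norm_smul, Real.norm_of_nonneg χ.nonneg]
  exact mul_le_of_le_one_left (norm_nonneg _) χ.le_one

/-- **The cut-off field satisfies the Cauchy–Lipschitz hypotheses.**  For `u` jointly smooth on an OPEN set of times `S`, the field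
`w = χ u` has, on every compact `C ⊆ S`, a gradient bounded uniformly in space (continuity on the compact `C × B̄(0, r_out)`, zero
outside), hence `ODE.IsUniformlyLipschitzOn w S` (`IsSmoothSpaceTimeOn.isUniformlyLipschitzOn_of_norm_fderiv_le`).
[cite: MajdaBertozziCUP2002, §4.2 proof of Thm. 4.3 (Q(s) = |∇v(·,s)|₀)] -/
theorem isUniformlyLipschitzOn_bump_smul (χ : ContDiffBump (0 : EuclideanSpace ℝ (Fin 3))) (hSo : IsOpen S)
    (hu : IsSmoothSpaceTimeOn S u) : ODE.IsUniformlyLipschitzOn (fun t x => χ x • u t x) S := by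
  have hw := isSmoothSpaceTimeOn_bump_smul χ hu
  refine hw.isUniformlyLipschitzOn_of_norm_fderiv_le fun C hC hCS => ?_
  have hD : ContinuousOn (uncurry fun t x => fderiv ℝ (fun z => χ z • u t z) x)
      (S ×ˢ (univ : Set (EuclideanSpace ℝ (Fin 3)))) :=
    (hw.fderiv_slice hSo.uniqueDiffOn).continuousOn
  obtain ⟨M, hM⟩ := (hC.prod (isCompact_closedBall (0 : EuclideanSpace ℝ (Fin 3)) χ.rOut)).exists_bound_of_continuousOn
    (hD.mono (prod_mono hCS (subset_univ _)))
  refine ⟨max M 0, fun t ht x => ?_⟩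
  by_cases hx : x ∈ closedBall (0 : EuclideanSpace ℝ (Fin 3)) χ.rOut
  · exact (hM (t, x) ⟨ht, hx⟩).trans (le_max_left _ _)
  · rw [mem_closedBall, dist_zero_right, not_le] at hx
    rw [fderiv_bump_smul_eq_zero χ (u t) hx, norm_zero]
    exact le_max_right _ _

/-! ### Confinement under a sub-parabolic speed bound -/

/-- **Confinement.**  Under the Cauchy–Lipschitz hypotheses on an open convex set of times `S ∋ t₁ ≤ t₀ < 0`, a speed bound
`‖w(s, y)‖ ≤ M₀ (−s)^{−κ₀}` for `s ∈ [t₁, t₀]` (`κ₀ < 1`) bounds the backward displacement of the trajectory through `x` at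
time `t₀`: `‖φ(s, t₀, x) − x‖ ≤ M₀((−s)^{1−κ₀} − (−t₀)^{1−κ₀})/(1−κ₀)` for all `s ∈ [t₁, t₀]` (the moving-bound mean-value inequality applied to
`r ↦ φ(t₀ − r, t₀, x) − x` with the bound `B(r) = M₀((r − t₀)^{1−κ₀} − (−t₀)^{1−κ₀})/(1−κ₀)`, `B' = M₀ (r − t₀)^{−κ₀}`).
[cite: MajdaBertozziCUP2002, §4.2 (4.48) (control of particle trajectories)] -/
theorem norm_evolutionMap_sub_le (hL : ODE.IsUniformlyLipschitzOn w S) (hS : Convex ℝ S) (hSo : IsOpen S)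
    {t₁ t₀ : ℝ} (ht₁ : t₁ ∈ S) (ht₀ : t₀ ∈ S) (ht₀0 : t₀ < 0)
    {M₀ κ₀ : ℝ} (hκ₀ : κ₀ < 1)
    (hspeed : ∀ s ∈ Icc t₁ t₀, ∀ y, ‖w s y‖ ≤ M₀ * (-s) ^ (-κ₀))
    (x : EuclideanSpace ℝ (Fin 3)) {s : ℝ} (hs : s ∈ Icc t₁ t₀) :
    ‖ODE.evolutionMap w t₀ s x - x‖ ≤ M₀ / (1 - κ₀) * ((-s) ^ (1 - κ₀) - (-t₀) ^ (1 - κ₀)) := by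
  have hIS : Icc t₁ t₀ ⊆ S := hS.ordConnected.out ht₁ ht₀
  set γ : ℝ → EuclideanSpace ℝ (Fin 3) := fun r => ODE.evolutionMap w t₀ r x with hγdef
  have hγ : ∀ r ∈ S, HasDerivAt γ (w r (γ r)) r := fun r hr =>
    hL.hasDerivAt_evolutionMap hS ht₀ (hSo.mem_nhds hr) x
  -- the reversed, recentred curve
  set T : ℝ := t₀ - t₁ with hT
  set f : ℝ → EuclideanSpace ℝ (Fin 3) := fun r => γ (t₀ - r) - x with hf
  have hfder : ∀ r ∈ Icc 0 T, HasDerivAt f ((-1 : ℝ) • w (t₀ - r) (γ (t₀ - r))) r := by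
    intro r hr
    have hmem : t₀ - r ∈ S := hIS ⟨by rw [hT] at hr; linarith [hr.2], by linarith [hr.1]⟩
    have h1 : HasDerivAt (fun r : ℝ => t₀ - r) (-1) r := by
      simpa using (hasDerivAt_id r).const_sub t₀
    have h2 := (hγ (t₀ - r) hmem).scomp r h1
    exact h2.sub_const x
  have hfc : ContinuousOn f (Icc 0 T) := fun r hr => (hfder r hr).continuousAt.continuousWithinAt
  have hf' : ∀ r ∈ Ico 0 T, HasDerivWithinAt f ((-1 : ℝ) • w (t₀ - r) (γ (t₀ - r))) (Ici r) r :=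
    fun r hr => (hfder r (Ico_subset_Icc_self hr)).hasDerivWithinAt
  -- the moving bound
  set B : ℝ → ℝ := fun r => M₀ / (1 - κ₀) * (r - t₀) ^ (1 - κ₀) - M₀ / (1 - κ₀) * (-t₀) ^ (1 - κ₀) with hB
  have h1κ : 0 < 1 - κ₀ := by linarith
  have hBc : ContinuousOn B (Icc 0 T) := by
    have hc : Continuous fun r : ℝ => (r - t₀) ^ (1 - κ₀) :=
      (continuous_id.sub continuous_const).rpow_const fun _ => Or.inr h1κ.le
    exact ((continuous_const.mul hc).sub continuous_const).continuousOn
  have hB' : ∀ r ∈ Ico 0 T, HasDerivWithinAt B (M₀ * (r - t₀) ^ (-κ₀)) (Ici r) r := by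
    intro r hr
    have hpos : 0 < r - t₀ := by linarith [hr.1]
    have h1 : HasDerivAt (fun r : ℝ => (r - t₀) ^ (1 - κ₀)) ((1 : ℝ) * (1 - κ₀) * (r - t₀) ^ (1 - κ₀ - 1)) r :=
      ((hasDerivAt_id r).sub_const t₀).rpow_const (Or.inl hpos.ne')
    have h2 := (h1.const_mul (M₀ / (1 - κ₀))).sub_const (M₀ / (1 - κ₀) * (-t₀) ^ (1 - κ₀))
    have h3 : M₀ / (1 - κ₀) * (1 * (1 - κ₀) * (r - t₀) ^ (1 - κ₀ - 1)) = M₀ * (r - t₀) ^ (-κ₀) := by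
      rw [show (1 : ℝ) - κ₀ - 1 = -κ₀ by ring]
      field_simp
    rw [h3] at h2
    exact h2.hasDerivWithinAt
  have hf0 : ‖f 0‖ ≤ B 0 := by
    simp [hf, hγdef, hB]
  have hbound : ∀ r ∈ Ico 0 T, ‖(-1 : ℝ) • w (t₀ - r) (γ (t₀ - r))‖ ≤ M₀ * (r - t₀) ^ (-κ₀) := by
    intro r hr
    rw [norm_smul, norm_neg, norm_one, one_mul]
    have hmem : t₀ - r ∈ Icc t₁ t₀ := ⟨by rw [hT] at hr; linarith [hr.2], by linarith [hr.1]⟩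
    have := hspeed (t₀ - r) hmem (γ (t₀ - r))
    rwa [show -(t₀ - r) = r - t₀ by ring] at this
  have hmain := image_norm_le_of_norm_deriv_right_le_deriv_boundary' hfc hf' hf0 hBc hB' hbound
  -- read off at `r = t₀ - s`
  have hr : t₀ - s ∈ Icc 0 T := ⟨by linarith [hs.2], by rw [hT]; linarith [hs.1]⟩
  have h := hmain hr
  have e1 : f (t₀ - s) = ODE.evolutionMap w t₀ s x - x := by
    simp [hf, hγdef]
  have e2 : B (t₀ - s) = M₀ / (1 - κ₀) * ((-s) ^ (1 - κ₀) - (-t₀) ^ (1 - κ₀)) := by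
    simp only [hB]
    rw [show t₀ - s - t₀ = -s by ring]
    ring
  rwa [e1, e2] at h

/-! ### The symmetry axis is invariant -/

/-- **The flow preserves the symmetry axis.**  If the horizontal components of `w(s, ·)` vanish on the axis for every `s ∈ S`
(convex set of times, Cauchy–Lipschitz hypotheses), then a particle on the axis at time `t₀` is on the axis at every time `t ∈ S`:
the solution of the reduced scalar equation `ζ' = w₂(s, ζ e₂)` on the axis is a trajectory, and trajectories are unique
(`ODE.IsUniformlyLipschitzOn.evolutionMap_eq`). [cite: Teschl2012, Thm. 2.2 (uniqueness)] -/
theorem evolutionMap_mem_axis (hL : ODE.IsUniformlyLipschitzOn w S) (hS : Convex ℝ S)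
    (haxis : ∀ s ∈ S, ∀ z : EuclideanSpace ℝ (Fin 3), z 0 = 0 → z 1 = 0 → w s z 0 = 0 ∧ w s z 1 = 0)
    {t₀ t : ℝ} (ht₀ : t₀ ∈ S) (ht : t ∈ S) {z : EuclideanSpace ℝ (Fin 3)} (hz0 : z 0 = 0) (hz1 : z 1 = 0) :
    ODE.evolutionMap w t₀ t z 0 = 0 ∧ ODE.evolutionMap w t₀ t z 1 = 0 := by
  set e₂ : EuclideanSpace ℝ (Fin 3) := EuclideanSpace.single (2 : Fin 3) (1 : ℝ) with he₂
  have he0 : e₂ 0 = 0 := by simp [he₂]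
  have he1 : e₂ 1 = 0 := by simp [he₂]
  have he2 : e₂ 2 = 1 := by simp [he₂]
  have hne : ‖e₂‖ = 1 := by simp [he₂]
  -- the reduced scalar field on the axis
  set W : ℝ → ℝ → ℝ := fun s ζ => w s (ζ • e₂) 2 with hW
  have hWL : ODE.IsUniformlyLipschitzOn W S := by
    refine ⟨fun ζ => ?_, fun C hC hCS => ?_⟩
    · have hc := hL.continuousOn (ζ • e₂)
      exact ((EuclideanSpace.proj (2 : Fin 3)).continuous).comp_continuousOn hc
    · obtain ⟨K, hK⟩ := hL.exists_lipschitzWith hC hCS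
      refine ⟨K, fun s hs => LipschitzWith.of_dist_le_mul fun ζ ζ' => ?_⟩
      have h1 := (hK s hs).dist_le_mul (ζ • e₂) (ζ' • e₂)
      have h2 : dist (ζ • e₂) (ζ' • e₂) = dist ζ ζ' := by
        rw [dist_eq_norm, ← sub_smul, norm_smul, hne, mul_one, Real.dist_eq, Real.norm_eq_abs]
      have h3 : dist (W s ζ) (W s ζ') ≤ dist (w s (ζ • e₂)) (w s (ζ' • e₂)) := by
        simp only [hW]
        rw [dist_eq_norm, dist_eq_norm, ← PiLp.sub_apply]
        exact PiLp.norm_apply_le _ 2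
      calc dist (W s ζ) (W s ζ') ≤ dist (w s (ζ • e₂)) (w s (ζ' • e₂)) := h3
        _ ≤ K * dist (ζ • e₂) (ζ' • e₂) := h1
        _ = K * dist ζ ζ' := by rw [h2]
  -- the axis trajectory
  set ζ : ℝ → ℝ := fun s => ODE.evolutionMap W t₀ s (z 2) with hζ
  set γ : ℝ → EuclideanSpace ℝ (Fin 3) := fun s => ζ s • e₂ with hγ
  have hγsol : ∀ s ∈ S, HasDerivWithinAt γ (w s (γ s)) S s := by
    intro s hs
    have h1 : HasDerivWithinAt ζ (W s (ζ s)) S s := hWL.hasDerivWithinAt_evolutionMap hS ht₀ hs (z 2)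
    have h2 : HasDerivWithinAt γ ((W s (ζ s)) • e₂) S s := h1.smul_const e₂
    have hax := haxis s hs (γ s) (by simp [hγ, he0]) (by simp [hγ, he1])
    have h3 : w s (γ s) = (W s (ζ s)) • e₂ := by
      ext i
      fin_cases i
      · simpa [he0] using hax.1
      · simpa [he1] using hax.2
      · simp [hW, hγ, he2]
    rw [h3]
    exact h2
  have heq : ODE.evolutionMap w t₀ t (γ t₀) = γ t := hL.evolutionMap_eq hS ht₀ hγsol ht
  have hγ0 : γ t₀ = z := by
    have h0 : ζ t₀ = z 2 := ODE.evolutionMap_self W t₀ (z 2)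
    ext i
    fin_cases i
    · simp [hγ, he0, hz0]
    · simp [hγ, he1, hz1]
    · simp [hγ, he2, h0]
  rw [hγ0] at heq
  rw [heq]
  exact ⟨by simp [hγ, he0], by simp [hγ, he1]⟩

/-- **Off-axis particles stay off the axis** (invariance of the axis under the backward map + the group law). [folklore] -/
theorem cylRadius_evolutionMap_ne_zero (hL : ODE.IsUniformlyLipschitzOn w S) (hS : Convex ℝ S)
    (haxis : ∀ s ∈ S, ∀ z : EuclideanSpace ℝ (Fin 3), z 0 = 0 → z 1 = 0 → w s z 0 = 0 ∧ w s z 1 = 0)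
    {t₀ t : ℝ} (ht₀ : t₀ ∈ S) (ht : t ∈ S) {x : EuclideanSpace ℝ (Fin 3)} (hx : cylRadius x ≠ 0) :
    cylRadius (ODE.evolutionMap w t₀ t x) ≠ 0 := by
  intro h0
  obtain ⟨h0', h1'⟩ := (cylRadius_eq_zero_iff _).1 h0
  have hback := evolutionMap_mem_axis hL hS haxis ht ht₀ h0' h1'
  rw [hL.evolutionMap_symm hS ht₀ ht x] at hback
  exact hx ((cylRadius_eq_zero_iff x).2 hback)

/-! ### Incompressibility along confined trajectories -/

/-- **Liouville's formula with vanishing divergence along the trajectory gives `det Dφ = 1`.** [cite: MajdaBertozziCUP2002, §1.3 Prop. 1.4] -/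
theorem det_fderiv_evolutionMap_eq_one_of_divergence (hL : ODE.IsUniformlyLipschitzOn w S) (hw : IsSmoothSpaceTimeOn S w)
    (hS : Convex ℝ S) (hU : UniqueDiffOn ℝ S) {t₀ t : ℝ} (ht₀ : t₀ ∈ S) (ht : t ∈ S) (x : EuclideanSpace ℝ (Fin 3))
    (hdiv : ∀ s ∈ uIcc t₀ t, VectorCalculus.divergence (w s) (ODE.evolutionMap w t₀ s x) = 0) :
    (fderiv ℝ (ODE.evolutionMap w t₀ t) x).det = 1 := by
  rw [det_fderiv_evolutionMap_eq_exp_integral_divergence_of_mem hL hw hS hU ht₀ ht x,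
    intervalIntegral.integral_congr (g := fun _ => (0 : ℝ)) hdiv]
  simp

/-- **Change of variables under an incompressible evolution map with confinement**: if `det Dφ(t,t₀,·) = 1` on a measurable set `A`
and `φ(t,t₀,A) ⊆ B`, then `∫_A G ∘ φ = ∫_{φ(A)} G ≤ ∫_B G` for every `G ≥ 0` (`φ` is a smooth bijection;
Mathlib `lintegral_image_eq_lintegral_abs_det_fderiv_mul`). [cite: MajdaBertozziCUP2002, §1.3 proof of Prop. 1.3 (change of variables)] -/
theorem lintegral_comp_evolutionMap_le (hL : ODE.IsUniformlyLipschitzOn w S) (hw : IsSmoothSpaceTimeOn S w)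
    (hS : Convex ℝ S) (hU : UniqueDiffOn ℝ S) {t₀ t : ℝ} (ht₀ : t₀ ∈ S) (ht : t ∈ S)
    {A B : Set (EuclideanSpace ℝ (Fin 3))} (hA : MeasurableSet A)
    (hdet : ∀ x ∈ A, (fderiv ℝ (ODE.evolutionMap w t₀ t) x).det = 1)
    (hAB : MapsTo (ODE.evolutionMap w t₀ t) A B) (G : EuclideanSpace ℝ (Fin 3) → ℝ≥0∞) :
    ∫⁻ x in A, G (ODE.evolutionMap w t₀ t x) ≤ ∫⁻ y in B, G y := by
  have hdiff : ∀ x ∈ A, HasFDerivWithinAt (ODE.evolutionMap w t₀ t)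
      (fderiv ℝ (ODE.evolutionMap w t₀ t) x) A x := fun x _ =>
    (((hL.contDiff_evolutionMap hS hU le_top hw ht₀ ht).differentiable (by simp)) x).hasFDerivAt.hasFDerivWithinAt
  have hinj : InjOn (ODE.evolutionMap w t₀ t) A := (hL.bijective_evolutionMap hS ht₀ ht).injective.injOn
  have hcv := lintegral_image_eq_lintegral_abs_det_fderiv_mul volume hA hdiff hinj G
  have h1 : ∫⁻ x in A, G (ODE.evolutionMap w t₀ t x) =
      ∫⁻ x in A, ENNReal.ofReal |(fderiv ℝ (ODE.evolutionMap w t₀ t) x).det| * G (ODE.evolutionMap w t₀ t x) :=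
    setLIntegral_congr_fun hA fun x hx => by rw [hdet x hx, abs_one, ENNReal.ofReal_one, one_mul]
  rw [h1, ← hcv]
  exact lintegral_mono_set hAB.image_subset

end Summit.NavierStokesRegularity.NavierStokesRegularity.Theorems.PowerGaugeEulerLiouville.SwirlfreeLedger

end
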